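import Literature.MathematicalPhysics.QuantumFieldTheory.Balaban1983to89.B15Claim189PinAtRecord
import Literature.MathematicalPhysics.QuantumFieldTheory.Balaban1983to89.B15Prop1Carrier

/-!
# BalabanUVNodes ∕ N12 — THE [IV] RESIDUAL LAYER OF RECORD WITH PRESCRIBED STEP SELECTOR AND PROPOSITION-1 CARRIER, AND WITH ALL THREE LETTERS PINNED; the [IV]
# displays `Node00.WDisplays₁₀` there (Stage-9 generic: valid at every record stage whose parameters extend `Node00.Stage9Params` — ₁₀, ₁₁, def-T's repaired ₁₂)
# (Track A, DAG node N12 = [B15, Balaban1989LargeFieldI] CMP 122 (1989) 175, basic step of 𝐑 (0.1)–(0.6) p.176, Prop. 1 p.194, (1.80), (1.89), (1.99)–(1.102); cluster K1 ∕ K1′;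
# seat `pub-ymgap-dag-n12-d` g2 (R134 fan-out, strategy s2 = by-name knit of the node's LANDED lineages), 2026-08-26; count-neutral)

WHY THIS FILE.  node00-def g30's `Node00.ResidW` leaves the [IV] letters of a run RESIDUAL: the step `kSel`, the Proposition-1 carrier `LF`, the (1.89) letters `D189`, the
(1.100) data `D1100`; `Node00.WDisplays₁₀ θ λ P` displays the p.176 term provisos + positive mass + [IV]'s four printed statements AT THOSE LETTERS.  Three N12 lineages have
since landed what pins them: the N12 s1 seat's `B15Prop1CarrierOnFromModel.prop1Printed_lfVarOn_of_model` (p457808: Proposition 1 AT THE CARRIER OF RECORD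
`B15Prop1Carrier.lfVarOn ch I`), the N12 s3 seat's `B15RPrime1100AtRecord` (p452570…v1.2: `ResidW.pinRPrime` — `D1100 :=` the 𝐑-step's (1.100)-reading, (1.102) a THEOREM there)
and `B15Claim189PinAtRecord` (p456430: `ResidW.pinD189` — `D189 := D189OfRecord θ P (σ P)`, r11's print's-instance setting at def-R's background of record, the (1.89)
SITUATION `σ P : Node00.Sit189` residual).  This file is the seat-s2 KNIT of the three, at the level of the residual layer (no record predicate, no stage above 9 — so it serves
this seat's Stage-12 modules `BalabanUVNodesN12AtRecord12CB10YZW ∕ …ExistsCurrency` and any later stage alike):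
* §1 `wDisplays₁₀_reLF` (the displays read `LF` only through `hP1`); `exists_residW_pinLF_printedDisplays` — a layer with `kSel = k`, `LF = L` at which (1.80) ∕ (1.89) ∕
  (1.102) hold DEGENERATELY (`χ_k(Ω_k^{∼4}) :≡ ⊥` letters, identity-insert 𝐑′-datum: g0's located species with the carrier slot handed to the caller);
  `exists_residW_pinLF_wDisplays₁₀_of_provisos₁₀` (term provisos + `Prop1Printed (L P)` ⇒ displays; below `K` positive mass + `Prop1Printed (L P)` alone);
  `prop1Printed_emptyCarrier` ∕ `prop1Printed_lfVarOn_of_isEmpty` (CENSUS: the empty carrier ∕ an empty instance family make Proposition 1 vacuous — the pin is contentful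
  exactly over inhabited families of print's instances).
* §2 THE LAYER WITH ALL THREE LETTERS PINNED `(λ.pinRPrime θ).pinD189 θ σ`: `pinAll_kSel ∕ _LF ∕ _D189 ∕ _pinD189 ∕ _pinRPrime` (`rfl` faces), and
  **`wDisplays₁₀_pinAll_of_deg`** — `WDisplays₁₀ θ ((λ.pinRPrime θ).pinD189 θ σ) P` on EVERY run from EXACTLY: `θ.Provisos₁₀`, the support-form provisos on runs with
  `P.K ≤ λ.kSel P` (n12-e's v1.2 degenerate-run clause; void below `K`), positive mass, `Prop1Printed (λ.LF P)`, (1.80) at `σ.dev0` with the record's `ε_k ∕ η_k`, (1.89) as one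
  display at `D189OfRecord θ P (σ P)` — (1.102) RETIRED (n12-e's `wDisplays₁₀_of_rPrimePin_deg` BY NAME); `b15Leaf_WOfRecord₁₀_pinAll_of_deg` (the [IV] leaf there).
* §3 (v1.1, append-only) CENSUS — `exists_sit189_not_new189`: a situation family with the (1.82) letter `chiP :≡ ⊥` voids `new189` at the pinned letters, so the (1.80) ∕
  (1.89) displays are VACUOUS there (`wDisplays₁₀_pinAll_of_deg_of_not_new189`, `b15Leaf_WOfRecord₁₀_pinAll_of_deg_of_not_new189`: the displays ∕ the leaf from the term
  provisos + positive mass + Proposition 1 ALONE) — the D189 pin is contentful exactly at the situation OF RECORD (NODE 00 has no `Sit189OfRecord` yet).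

HONEST FRAMING.  Count-neutral kernel BOOKKEEPING BY NAME; 0 `def` (the pins are n12-e's, the carrier lit-type-B15's ∕ n12-c's); nothing of Bałaban's asserted; N12 NOT
discharged: Proposition 1, (1.80), (1.89) and positive mass are HYPOTHESES here, displayed at pinned letters.  One finite four-torus programme at fixed `ε`; nothing continuum ∕
ℝ⁴ ∕ OS ∕ mass gap ∕ Clay.  0 `sorry`, standard axioms.  Filed `--supports` K1 (stmt-QuantumFields-19674).
Sources: [Balaban1989LargeFieldI] (0.2)–(0.6) p.176, Prop. 1 (1.77)–(1.78) p.194, (1.80) p.195, (1.89) p.198, (1.99)–(1.102) pp.200–201; [Balaban1988Convergent] (2.12) p.256,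
(2.16)–(2.18) p.257, (3.25) p.270; [Balaban1989LargeFieldII] pp.358–359.
-/

noncomputable section

open MeasureTheory

namespace Summit.QuantumFields.YangMills.BalabanUVNodes.N12ResidWPinnedLayer

open Literature.MathematicalPhysics.QuantumFieldTheory.Balaban1983to89
open Literature.MathematicalPhysics.QuantumFieldTheory.Balaban1983to89.T4Continuum (T4Family)
open Literature.MathematicalPhysics.QuantumFieldTheory.Balaban1983to89.DagBinding (B15Leaf)
open Literature.MathematicalPhysics.QuantumFieldTheory.Balaban1983to89.Node00
open B15Claim189Assembly (Setting189 new189 chiPP dom)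
open B15Sect1Statements (RPrimeData Normalization1102 rPrime1100)
open B15 (LFVar Prop1Printed Ineq180)
open B15.BasicStep (Claim189)
open B8Eq17ClassAkV1 (plaqsOf)
open B16Sect1Backgrounds (ExpChart)
open B15Prop1Carrier (InstOn lfVarOn)
open B15RPrime1100OfRep (rPrimeDataOfSel)
open B15Claim189PinAtRecord (D189OfRecord)

variable {N : ℕ} [NeZero N] {F : T4Family}

/-! ## §1 THE LAYER WITH PRESCRIBED STEP SELECTOR AND PROPOSITION-1 CARRIER -/

section Letters

/-- **THE [IV] DISPLAYS READ THE PROPOSITION-1 CARRIER ONLY THROUGH `hP1`**: re-layering `λ.LF := L` with a supplied display `Prop1Printed (L P)` keeps `WDisplays₁₀ θ · P`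
(the term provisos read `kSel`, (1.80) ∕ (1.89) read `D189`, (1.102) reads `D1100` and `kSel`). [cite: Balaban1989LargeFieldI, Prop. 1 (1.78) p.194, (0.2)–(0.6) p.176, (1.80) p.195, (1.89) p.198, (1.102) p.201 (bookkeeping: which letter each display reads)] -/
theorem wDisplays₁₀_reLF {θ : Stage9Params F N} {lam : ResidW F N} {P : B12.RunParams} (hd : WDisplays₁₀ θ lam P) (L : B12.RunParams → LFVar)
    (hL : Prop1Printed (L P)) : WDisplays₁₀ θ { lam with LF := L } P :=
  ⟨hd.hm, hd.h0, hd.hC, hd.hmass, hL, hd.h180, hd.h189, hd.h1102⟩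

/-- **A RESIDUAL LAYER WITH PRESCRIBED STEP SELECTOR AND PROPOSITION-1 CARRIER at which the THREE OTHER printed displays hold degenerately**, for every Stage-9 parameter:
`kSel := k`, `LF := L`; (1.89) letters on the coarsest lattice with one-point carriers and `chiΩ4 :≡ ⊥`, so `new189 ≡ ⊥` and both the (1.80) display and
`Claim189 (new189 ·) (chiPP ·)` are VACUOUS; the (1.100) datum of 𝐑′ with ONE large-field pattern, ONE 𝕋″-term acting as the constant `𝐓ρ_k` of record and NO inserts, so
`rPrime1100 D = 𝐓ρ_k` and (1.102) is an identity (this seat's g0 letters, the carrier slot handed to the caller).  Census (A2 ∕ R433 species): `D189 ∕ D1100` stay residual.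
[cite: Balaban1989LargeFieldI, (1.80) p.195, (1.89) p.198, (1.100)–(1.102) p.201 (bookkeeping: junk satisfiability of the typed statements at residual letters)] -/
theorem exists_residW_pinLF_printedDisplays (θ : Stage9Params F N) (k : B12.RunParams → ℕ) (L : B12.RunParams → LFVar) :
    ∃ lam : ResidW F N, lam.kSel = k ∧ lam.LF = L ∧ ∀ P : B12.RunParams,
      (∀ U, new189 (lam.D189 P) U → ∀ i, (lam.D189 P).h ≤ i → i ≤ (lam.D189 P).k → ∀ q ∈ plaqsOf (dom (lam.D189 P) i),
        Ineq180 ((lam.D189 P).dev0 U q) ((lam.D189 P).ε (lam.D189 P).k) (lam.D189 P).η (lam.D189 P).B₃ (lam.D189 P).B₅ (lam.D189 P).M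
          (lam.D189 P).δ ((lam.D189 P).dist q) (lam.D189 P).O1) ∧
      Claim189 (new189 (lam.D189 P)) (chiPP (lam.D189 P)) ∧
      Normalization1102 (lam.D1100 P) (trhoOfRecord9 F N θ.ν θ.τ9 (EOfRecord₁₀ F N θ) (wOfRecord₉ F N θ) θ.ppSel P (gOfRecord₁₀ F N θ P) (lam.kSel P)) := by
  refine ⟨⟨k, fun _ => F.P 0, fun _ => PUnit, fun _ => PUnit, L,
      fun _ => ⟨fun _ => ∅, fun _ => ∅, ∅, 0, 0, 0, 0, 0, 0, 0, fun _ => 0, 0, 0, 0, 0, 0, 0, fun _ => 0, fun _ => False, fun _ => True, fun _ => True,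
        fun _ => ∅, ∅, fun _ _ => 1, fun _ => PUnit.unit, ∅, fun _ _ => 1, fun _ => 1, fun _ _ => 0, fun _ _ => 0, fun _ _ => 0⟩,
      fun P =>
        { ZK := PUnit, TT := fun _ => PUnit,
          ttOp := fun _ _ _ => trhoOfRecord9 F N θ.ν θ.τ9 (EOfRecord₁₀ F N θ) (wOfRecord₉ F N θ) θ.ppSel P (gOfRecord₁₀ F N θ P) (k P),
          Fam := fun _ => PEmpty, fam := fun _ e => e.elim, expA := fun _ _ => 0 }⟩, rfl, rfl, fun P => ⟨?_, ?_, ?_⟩⟩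
  · rintro U ⟨h4, -⟩
    exact h4.elim
  · rintro U ⟨h4, -⟩
    exact h4.elim
  · unfold Normalization1102 rPrime1100
    simp

/-- **SO, PER RUN, WHAT THE DISPLAYS COST ONCE THE PROPOSITION-1 CARRIER IS PINNED**: for every Stage-9 parameter WITH ITS STAGE-10 PROVISOS, step selector `k` and
carrier family `L` WITH ITS DISPLAYS `Prop1Printed (L P)`, there is ONE residual layer with `kSel = k`, `LF = L` such that at every run `P`: the four term provisos at step
`k P` give `WDisplays₁₀ θ λ P`; and on runs with `k P < P.K` POSITIVE MASS ALONE gives it — three of the four term provisos (measurable ∕ ≥ 0 ∕ bounded pre-𝐑 terms) ARE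
THE RECORD'S OWN there (def-T's `Provisos₁₀.rstep P k hk`). [cite: Balaban1989LargeFieldI, (0.2)–(0.6) p.176, Prop. 1 (1.78) p.194, (1.80) p.195, (1.89) p.198, (1.102) p.201 (bookkeeping)] -/
theorem exists_residW_pinLF_wDisplays₁₀_of_provisos₁₀ (θ : Stage9Params F N) (h : θ.Provisos₁₀) (k : B12.RunParams → ℕ) (L : B12.RunParams → LFVar)
    (hL : ∀ P, Prop1Printed (L P)) :
    ∃ lam : ResidW F N, lam.kSel = k ∧ lam.LF = L ∧ ∀ P : B12.RunParams,
      ((∀ s, Measurable (rterm (reprTOfRecord₁₀ F N θ P (k P)) s)) → (∀ s V, 0 ≤ rterm (reprTOfRecord₁₀ F N θ P (k P)) s V) →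
        (∃ Cρ : ℝ, ∀ s V, rterm (reprTOfRecord₁₀ F N θ P (k P)) s V ≤ Cρ) →
        (∀ s, 0 < ∫ V, rterm (reprTOfRecord₁₀ F N θ P (k P)) s V ∂(fieldMeasure (F.P P.K) (k P + 1) (SU N))) → WDisplays₁₀ θ lam P) ∧
      (k P < P.K → (∀ s, 0 < ∫ V, rterm (reprTOfRecord₁₀ F N θ P (k P)) s V ∂(fieldMeasure (F.P P.K) (k P + 1) (SU N))) →
        WDisplays₁₀ θ lam P) := by
  obtain ⟨lam, hk, hLF, hd⟩ := exists_residW_pinLF_printedDisplays θ k L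
  subst hk hLF
  refine ⟨lam, rfl, rfl, fun P => ⟨fun hm h0 hC hmass => ⟨hm, h0, hC, hmass, hL P, (hd P).1, (hd P).2.1, (hd P).2.2⟩, fun hK hmass => ?_⟩⟩
  obtain ⟨hm, h0, hC, -⟩ := h.rstep P (lam.kSel P) hK
  exact ⟨hm, h0, hC, hmass, hL P, (hd P).1, (hd P).2.1, (hd P).2.2⟩

/-- **CENSUS — the degenerate corner of the carrier slot**: at the EMPTY Proposition-1 carrier (no instances) `Prop1Printed` holds vacuously (`B₅ := 1`).
[cite: Balaban1989LargeFieldI, Prop. 1 (1.78) p.194 (bookkeeping: the typed statement at a residual carrier)] -/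
theorem prop1Printed_emptyCarrier :
    Prop1Printed ⟨PEmpty, fun i => i.elim, fun i => i.elim, fun i => i.elim, fun i => i.elim, fun i => i.elim, fun i => i.elim, fun i => i.elim, fun i => i.elim⟩ :=
  ⟨1, one_pos, fun i => i.elim⟩

/-- **CENSUS — the degenerate corner of the carrier of record**: over an EMPTY instance family `Prop1Printed (lfVarOn ch I)` holds vacuously (`B₅ := 1`); so pinning
`λ.LF P := lfVarOn ch (I P)` is contentful exactly when `I P` ranges over an inhabited family of print's instances (the large-field components `Λ` of `Z^c` at the step, with
their data `V_k` and the function (1.77) on its domain — lit-type-B15's `B15Prop1Carrier.InstOn.std`). [cite: Balaban1989LargeFieldI, Prop. 1 (1.77)–(1.78) p.194 (bookkeeping: the typed statement over an empty instance family)] -/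
theorem prop1Printed_lfVarOn_of_isEmpty {𝔤 : Type*} [AddCommGroup 𝔤] [Module ℝ 𝔤] {P : Params} {G : Type} [GaugeGroup G] (ch : ExpChart G 𝔤) {ι : Type}
    [IsEmpty ι] (I : ι → InstOn P G) : Prop1Printed (lfVarOn ch I) :=
  ⟨1, one_pos, fun i => (‹IsEmpty ι›.false i).elim⟩

end Letters

/-! ## §2 THE LAYER WITH ALL THREE LETTERS PINNED `(λ.pinRPrime θ).pinD189 θ σ` — faces, and the displays there on every run -/

section AllPinned

variable (θ : Stage9Params F N) (lam : ResidW F N) (σ : ∀ P : B12.RunParams, Sit189 F N P.K)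

/-- The doubly pinned layer keeps the step selector (`rfl`). [cite: Balaban1989LargeFieldI, (0.2) p.176 (bookkeeping)] -/
theorem pinAll_kSel : ((lam.pinRPrime θ).pinD189 θ σ).kSel = lam.kSel := rfl

/-- The doubly pinned layer keeps the Proposition-1 carrier (`rfl`) — the slot the caller fills (`lfVarOn ch (I P)` for print's carrier). [cite: Balaban1989LargeFieldI, Prop. 1 p.194 (bookkeeping)] -/
theorem pinAll_LF : ((lam.pinRPrime θ).pinD189 θ σ).LF = lam.LF := rfl

/-- Its (1.89) letters at run `P` ARE the letters of record `D189OfRecord θ P (σ P)` (`rfl`). [cite: Balaban1989LargeFieldI, (1.89) p.198 (bookkeeping)] -/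
theorem pinAll_D189 (P : B12.RunParams) : ((lam.pinRPrime θ).pinD189 θ σ).D189 P = D189OfRecord θ P (σ P) := rfl

/-- Its (1.100) data at run `P` IS the 𝐑-step's (1.100)-reading at the run's step (`rfl`). [cite: Balaban1989LargeFieldI, (1.100) p.201 (bookkeeping)] -/
theorem pinAll_D1100 (P : B12.RunParams) :
    ((lam.pinRPrime θ).pinD189 θ σ).D1100 P
      = rPrimeDataOfSel (repTOfRecord9 F N θ.ν θ.τ9 (EOfRecord₁₀ F N θ) (wOfRecord₉ F N θ) θ.ppSel P (gOfRecord₁₀ F N θ P) (lam.kSel P))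
          (θ.ppSel P (gOfRecord₁₀ F N θ P) (lam.kSel P + 1)) (fibOfSeq F θ.ν θ.τ9 P (gOfRecord₁₀ F N θ P) (lam.kSel P + 1)) := rfl

/-- The doubly pinned layer is FIXED by the (1.89) pin (`rfl`). [cite: Balaban1989LargeFieldI, (1.89) p.198 (bookkeeping)] -/
theorem pinAll_pinD189 : ((lam.pinRPrime θ).pinD189 θ σ).pinD189 θ σ = (lam.pinRPrime θ).pinD189 θ σ := rfl

/-- … and by the (1.100) pin (`rfl`; n12-e's `pinD189_pinRPrime_comm`, `pinRPrime_pinRPrime`). [cite: Balaban1989LargeFieldI, (1.100) p.201 (bookkeeping)] -/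
theorem pinAll_pinRPrime : ((lam.pinRPrime θ).pinD189 θ σ).pinRPrime θ = (lam.pinRPrime θ).pinD189 θ σ := rfl

variable {θ lam}

/-- **THE [IV] DISPLAYS AT THE LAYER WITH ALL THREE LETTERS PINNED, ON EVERY RUN** — n12-e's `B15RPrime1100AtRecord.wDisplays₁₀_of_rPrimePin_deg` at `(λ.pinRPrime θ).pinD189 θ σ`
(pin equation by `rfl`): `θ.Provisos₁₀` + «on a run with `P.K ≤ λ.kSel P` the support-form provisos of the knit datum at the run's step» (`hdeg`; below `K` the record's own
`rstep` serves) + positive mass of the pre-𝐑 terms + `Prop1Printed (λ.LF P)` + (1.80) on the ℍ-domains at the situation's letter `σ.dev0` with the record's `ε_k ∕ η_k` + (1.89)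
as ONE display at the letters of record ⇒ `WDisplays₁₀`; the (1.102) display is a THEOREM at the pinned (1.100) data (retired). [cite: Balaban1989LargeFieldI, (0.2)–(0.4) p.176, Prop. 1 (1.78) p.194, (1.80) p.195, (1.89) p.198, (1.99)–(1.102) pp.200–201; Balaban1988Convergent, (2.12) p.256, (2.16)–(2.17) p.257, (3.25) p.270 (the pinned objects)] -/
theorem wDisplays₁₀_pinAll_of_deg (hP : θ.Provisos₁₀) {P : B12.RunParams}
    (hdeg : P.K ≤ lam.kSel P →
      (repDataOfSel (repTOfRecord9 F N θ.ν θ.τ9 (EOfRecord₁₀ F N θ) (wOfRecord₉ F N θ) θ.ppSel P (gOfRecord₁₀ F N θ P) (lam.kSel P))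
        (θ.ppSel P (gOfRecord₁₀ F N θ P) (lam.kSel P + 1)) (fibOfSeq F θ.ν θ.τ9 P (gOfRecord₁₀ F N θ P) (lam.kSel P + 1))).ProvisosSupp)
    (hmass : ∀ s, 0 < ∫ V, rterm (repTOfRecord9 F N θ.ν θ.τ9 (EOfRecord₁₀ F N θ) (wOfRecord₉ F N θ) θ.ppSel P (gOfRecord₁₀ F N θ P) (lam.kSel P)) s V
      ∂(fieldMeasure (F.P P.K) (lam.kSel P + 1) (SU N)))
    (hP1 : Prop1Printed (lam.LF P))
    (h180 : ∀ U, new189 (D189OfRecord θ P (σ P)) U → ∀ i, (σ P).h ≤ i → i ≤ (σ P).k → ∀ q ∈ plaqsOf (dom (D189OfRecord θ P (σ P)) i),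
      Ineq180 ((σ P).dev0 U.1 q) (epsOfRecord θ.ν (gOfRecord₁₀ F N θ P) (σ P).k) ((F.P P.K).eta (σ P).k) (σ P).B₃ (σ P).B₅ (σ P).M (σ P).δ ((σ P).dist q) (σ P).O1)
    (h189 : Claim189 (new189 (D189OfRecord θ P (σ P))) (chiPP (D189OfRecord θ P (σ P)))) :
    WDisplays₁₀ θ ((lam.pinRPrime θ).pinD189 θ σ) P :=
  B15RPrime1100AtRecord.wDisplays₁₀_of_rPrimePin_deg (lam := (lam.pinRPrime θ).pinD189 θ σ) hP hdeg rfl hmass hP1 h180 h189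

/-- **THE [IV] LEAF AT THE STAGE-10 BUNDLE OF RECORD WITH ALL THREE LETTERS PINNED, ON EVERY RUN** (node00-def g30's `b15Leaf_WOfRecord₁₀_of_displays` at the layer; at any
stage extending `Stage9Params` the bundle of record is this one at `θ.toStage9Params`). [cite: Balaban1989LargeFieldI, (0.2)–(0.6) p.176, Prop. 1 (1.78) p.194, (1.80) p.195, (1.89) p.198, (1.102) p.201] -/
theorem b15Leaf_WOfRecord₁₀_pinAll_of_deg (hP : θ.Provisos₁₀) {P : B12.RunParams}
    (hdeg : P.K ≤ lam.kSel P →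
      (repDataOfSel (repTOfRecord9 F N θ.ν θ.τ9 (EOfRecord₁₀ F N θ) (wOfRecord₉ F N θ) θ.ppSel P (gOfRecord₁₀ F N θ P) (lam.kSel P))
        (θ.ppSel P (gOfRecord₁₀ F N θ P) (lam.kSel P + 1)) (fibOfSeq F θ.ν θ.τ9 P (gOfRecord₁₀ F N θ P) (lam.kSel P + 1))).ProvisosSupp)
    (hmass : ∀ s, 0 < ∫ V, rterm (repTOfRecord9 F N θ.ν θ.τ9 (EOfRecord₁₀ F N θ) (wOfRecord₉ F N θ) θ.ppSel P (gOfRecord₁₀ F N θ P) (lam.kSel P)) s V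
      ∂(fieldMeasure (F.P P.K) (lam.kSel P + 1) (SU N)))
    (hP1 : Prop1Printed (lam.LF P))
    (h180 : ∀ U, new189 (D189OfRecord θ P (σ P)) U → ∀ i, (σ P).h ≤ i → i ≤ (σ P).k → ∀ q ∈ plaqsOf (dom (D189OfRecord θ P (σ P)) i),
      Ineq180 ((σ P).dev0 U.1 q) (epsOfRecord θ.ν (gOfRecord₁₀ F N θ P) (σ P).k) ((F.P P.K).eta (σ P).k) (σ P).B₃ (σ P).B₅ (σ P).M (σ P).δ ((σ P).dist q) (σ P).O1)
    (h189 : Claim189 (new189 (D189OfRecord θ P (σ P))) (chiPP (D189OfRecord θ P (σ P)))) :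
    B15Leaf (WOfRecord₁₀ F N θ ((lam.pinRPrime θ).pinD189 θ σ) P) :=
  b15Leaf_WOfRecord₁₀_of_displays (wDisplays₁₀_pinAll_of_deg σ hP hdeg hmass hP1 h180 h189)

end AllPinned

/-! ## §3 (v1.1, append-only) CENSUS — the (1.89) pin's content is carried by the residual SITUATION: its (1.82) letter `χ′` can void (1.80) and (1.89)

A2 (junk certificate for `σ`, the dag-lead's WORDS-102 (f3) species question, asked of every pinned display): the N12 s3 seat's `ResidW.pinD189` pins the (1.89) letters to
`D189OfRecord θ P (σ P)` — r11's print's-instance setting at def-R's background of record — but the per-run SITUATION `σ P : Node00.Sit189` (levels, regions, cube families,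
numbers, the (1.82) chart letter `chiP`, the deviation letters) is FREE data.  Its (1.82) letter is the fourth conjunct of `new189` (`Setting189.chi' := fun U => σ.chiP U.2`),
so at a situation with `chiP :≡ ⊥` NO configuration carries the new functions: the (1.80) display (`∀ U, new189 … U → …`) and `Claim189 (new189 ·) (chiPP ·)`
(`= ∀ U, new189 U → chiPP U`) are VACUOUS — the same species as g0's `chiΩ4 :≡ ⊥` certificate, one pin later.  Hence at the triply pinned layer the [IV] displays follow
from the term provisos, positive mass and Proposition 1 ALONE once `σ` is junk: the D189 pin is contentful exactly at the situation OF RECORD (the levels `h < k₀ < k` of the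
step, print's regions `Ω_j ∕ Z″_j ∕ Z ∕ Λ` of the run's large-field decomposition, the (1.82) function of the chart variable) — NODE 00 has no `Sit189OfRecord` yet (n12-e's
located (i)–(iv)).  Count-neutral; nothing of Bałaban's asserted. -/

section JunkSituation

variable (F N) in
/-- **A2 — A SITUATION FAMILY AT WHICH NO CONFIGURATION CARRIES THE NEW FUNCTIONS OF (1.89)**: n12-e's degenerate inhabitant of `Node00.Sit189` with the (1.82) letter
`chiP :≡ ⊥`; then `new189 (D189OfRecord θ P (σ P)) U` fails for every `θ`, `P`, `U` (its fourth conjunct IS `(σ P).chiP U.2`). [cite: Balaban1989LargeFieldI, (1.89) p.198, (1.82) p.196 (bookkeeping: the typed conjunct reads the residual (1.82) letter)] -/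
theorem exists_sit189_not_new189 :
    ∃ σ : ∀ P : B12.RunParams, Sit189 F N P.K, ∀ (θ : Stage9Params F N) (P : B12.RunParams) U, ¬ new189 (D189OfRecord θ P (σ P)) U :=
  ⟨fun P => { (nonempty_sit189 F N P.K).some with chiP := fun _ => False }, fun _ _ _ h => h.2.2.2⟩

/-- **AT SUCH A SITUATION THE (1.80) AND (1.89) DISPLAYS ARE VACUOUS**: the [IV] displays at the triply pinned layer `(λ.pinRPrime θ).pinD189 θ σ` follow on every run from
`θ.Provisos₁₀`, the degenerate-run support provisos, positive mass and `Prop1Printed (λ.LF P)` ALONE (`wDisplays₁₀_pinAll_of_deg` with `h180`, `h189` discharged ex falso).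
So a K1′ ∃-assembly that pins `D189` at a junk situation consumes nothing of (1.80) ∕ (1.89) — LOCATED, count-neutral. [cite: Balaban1989LargeFieldI, (0.2)–(0.6) p.176, Prop. 1 (1.78) p.194, (1.80) p.195, (1.89) p.198 (bookkeeping census)] -/
theorem wDisplays₁₀_pinAll_of_deg_of_not_new189 {θ : Stage9Params F N} {lam : ResidW F N} (σ : ∀ P : B12.RunParams, Sit189 F N P.K)
    (hσ : ∀ (P : B12.RunParams) U, ¬ new189 (D189OfRecord θ P (σ P)) U) (hP : θ.Provisos₁₀) {P : B12.RunParams}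
    (hdeg : P.K ≤ lam.kSel P →
      (repDataOfSel (repTOfRecord9 F N θ.ν θ.τ9 (EOfRecord₁₀ F N θ) (wOfRecord₉ F N θ) θ.ppSel P (gOfRecord₁₀ F N θ P) (lam.kSel P))
        (θ.ppSel P (gOfRecord₁₀ F N θ P) (lam.kSel P + 1)) (fibOfSeq F θ.ν θ.τ9 P (gOfRecord₁₀ F N θ P) (lam.kSel P + 1))).ProvisosSupp)
    (hmass : ∀ s, 0 < ∫ V, rterm (repTOfRecord9 F N θ.ν θ.τ9 (EOfRecord₁₀ F N θ) (wOfRecord₉ F N θ) θ.ppSel P (gOfRecord₁₀ F N θ P) (lam.kSel P)) s V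
      ∂(fieldMeasure (F.P P.K) (lam.kSel P + 1) (SU N)))
    (hP1 : Prop1Printed (lam.LF P)) :
    WDisplays₁₀ θ ((lam.pinRPrime θ).pinD189 θ σ) P :=
  wDisplays₁₀_pinAll_of_deg σ hP hdeg hmass hP1 (fun U hU => (hσ P U hU).elim) (fun U hU => (hσ P U hU).elim)

/-- **… and so is the [IV] leaf at the Stage-10 bundle of record there** (from the term provisos, positive mass and Proposition 1 alone).
[cite: Balaban1989LargeFieldI, (0.2)–(0.6) p.176, Prop. 1 (1.78) p.194 (bookkeeping census)] -/
theorem b15Leaf_WOfRecord₁₀_pinAll_of_deg_of_not_new189 {θ : Stage9Params F N} {lam : ResidW F N} (σ : ∀ P : B12.RunParams, Sit189 F N P.K)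
    (hσ : ∀ (P : B12.RunParams) U, ¬ new189 (D189OfRecord θ P (σ P)) U) (hP : θ.Provisos₁₀) {P : B12.RunParams}
    (hdeg : P.K ≤ lam.kSel P →
      (repDataOfSel (repTOfRecord9 F N θ.ν θ.τ9 (EOfRecord₁₀ F N θ) (wOfRecord₉ F N θ) θ.ppSel P (gOfRecord₁₀ F N θ P) (lam.kSel P))
        (θ.ppSel P (gOfRecord₁₀ F N θ P) (lam.kSel P + 1)) (fibOfSeq F θ.ν θ.τ9 P (gOfRecord₁₀ F N θ P) (lam.kSel P + 1))).ProvisosSupp)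
    (hmass : ∀ s, 0 < ∫ V, rterm (repTOfRecord9 F N θ.ν θ.τ9 (EOfRecord₁₀ F N θ) (wOfRecord₉ F N θ) θ.ppSel P (gOfRecord₁₀ F N θ P) (lam.kSel P)) s V
      ∂(fieldMeasure (F.P P.K) (lam.kSel P + 1) (SU N)))
    (hP1 : Prop1Printed (lam.LF P)) :
    B15Leaf (WOfRecord₁₀ F N θ ((lam.pinRPrime θ).pinD189 θ σ) P) :=
  b15Leaf_WOfRecord₁₀_of_displays (wDisplays₁₀_pinAll_of_deg_of_not_new189 σ hσ hP hdeg hmass hP1)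

end JunkSituation

end Summit.QuantumFields.YangMills.BalabanUVNodes.N12ResidWPinnedLayer

end
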